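/-
Copyright (c) 2026 the pub-hodgecm-mathlib formalisation cell (harness21).  Prover seat hodgecm-mathlib-LH4-p10 (g6) ((N-vol) lane; Track A «(D-RAM) FOUR-FRAME», STAGE-1b,
dealer LH4-plan (g13) D-1b DRAFT v2 §3 «counting producers: (N-vol-wild) LH4-p10»; heir LEAD F0P3a-plan (g20∕g21)).  2026-09-04.
-/
import Summits.HodgeConjecture.HodgeConjecture.Theorems.F0P3cDyRamStageOneBDefs      -- ★ DEFS LEAF №5 «STAGE-1b» (F0P3a-p01 (g36)): `laLowOfRecord`, `laHighOfRecord`, `csOfRecord`, `klOfRecord`, `mcOfRecord`, `sTOfRecord`; brings ★ №3 `mstarOfRecord`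
import HarnessLib

/-!
# (N-vol-exp) THE STAGE-1b SCHEDULES ARE THE LEVI FIBRE-VOLUME EXPONENTS — AT EVERY `d`

Crux `H413` (`stmt-HodgeConjecture-24833`), line «(D-RAM) FOUR-FRAME», STAGE-1b (tier-0 ED. 5∕6).  Helper lane `--supports stmt-HodgeConjecture-24833 --as helper`; COUNT-NEUTRAL
(pure `ℕ` arithmetic; pays no registered stub, touches no `Lines/` module).

WHAT.  ★ DEFS LEAF №5 `F0P3cDyRamStageOneBDefs` fixes the EXPONENT SHIFTS of the level laws of record — `csOfRecord d` (pieces `sq_{m*}`, `lev_{ℓ₀,m*}`), `klOfRecord d`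
(`lev_{ℓ₀+1,m*}`), `sTOfRecord d` (the clean halves `lev_{ℓ₀,m_c}` ∕ `lev_{ℓ₀+1,m_c}` and the labelled piece `T₊`) — and its docstrings SAY that each one «= ★ p859102's Levi
fibre-volume exponent for every `d`».  This file PROVES those sentences, as identities in `ℕ` valid at every `d` (one needs `2 ≤ d`), between
* the exponent of ★ `Literature.…HeisenbergWildLevelFibreVolume.measure_setOf_mem_and_levels_eq` (LH4-p10 (g5), p859102) — `μ_N{n ∈ K₃ : X ∈ ϖ^a M₃, X² ∈ ϖ^b M₃} =
  q^{−e(a,b;d)}·μ_N{K₃}` with `e(a,b;d) = (max (max a ⌈b∕2⌉) ⌊(a+d)∕2⌋ − ⌊d∕2⌋) + ⌈(a − d%2)∕2⌉`, the exponent of ★ `…measure_setOf_mem_and_sqLevel_eq` — `max ⌈m∕2⌉ ⌊d∕2⌋ − ⌊d∕2⌋`,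
  and the literal exponent `(d%2 + 3d − 1)∕2 − ⌊d∕2⌋` ∕ clean square level `2·((d%2 + 3d − 1)∕2)` of ★ p859349 ∕ ★ p859426 ∕ ★ p859477 (the `T₊`, `T₋`, clean-shell volumes), and
* the leaf's letters at the level pairs of record `(laLowOfRecord d, mstarOfRecord d)`, `(0, mstarOfRecord d)`, `(laHighOfRecord d, mstarOfRecord d)`, `(laLowOfRecord d, mcOfRecord d)`,
  `(laHighOfRecord d, mcOfRecord d)`.

WHY.  Row (3) (Levi) of every STAGE-1b H-side stub is ONE scalar identity (★ (V5-lev) `rowThree_levels_hFamily_of_scalar`, ★ (N15) `…PieceLeviRowScalarExact`) whose right-hand number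
carries `q_v^{−e(la d, lb d; d)}` with the exponent SPELLED as ★ p859102 spells it, while the law side (row (1), ★ (V7)∕(V8) affine letters `C·2q^{−ks}`) carries the leaf's shift
`ks ∈ {csOfRecord, klOfRecord, sTOfRecord}`: the check closes exactly when `e(la d, lb d; d) = ks d`.  The END producers of `stub_hside_levLo ∕ levHi ∕ sq` (LH4-p06 (g6)), the row-(3)
scalar organ (LH4-p08 (g7)) and the ED. 6 (H-T+) column (LH4-p14 (g6)) cite these identities BY NAME instead of re-splitting the parity of `d` at each use site
(`rw [dOfPlace = d, leviExp_laLow_mstarOfRecord d]`).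

HONEST LABEL.  Count-neutral; `HC_CM` is proved only modulo the 7 printed citations (2 remaining named inputs: hLiu418 = `stmt-HodgeConjecture-24832`, h413 =
`stmt-HodgeConjecture-24833`) until rung 0 closes; tier-0 rows `T₊ ∕ T₋ ∕ regular` OPEN.

## References
* [Rogawski1990] J. D. Rogawski, *Automorphic Representations of Unitary Groups in Three Variables*, Ann. of Math. Stud. 123 (1990), §4.9 Prop. 4.9.1 (a)(b) p. 55.
* [Kottwitz1986BaseChangeUnits] R. E. Kottwitz, *Base change for unit elements of Hecke algebras*, Compositio Math. 60 (1986), §1 pp. 240–241.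
-/

set_option autoImplicit false

namespace Summit.HodgeConjecture.HodgeConjecture.Cruxes.H413.F0P3cDyRamLeviExponentsOfRecord

open Summit.HodgeConjecture.HodgeConjecture.Cruxes.H413.F0P3cDyRamFourFramePieces (mstarOfRecord)
open Summit.HodgeConjecture.HodgeConjecture.Cruxes.H413.F0P3cDyRamStageOneBDefs

/-! ## §1  The literal exponents of the `T₊ ∕ T₋ ∕` clean-shell volumes (★ p859349 ∕ p859426 ∕ p859477) in the leaf's letters -/

/-- The square level of record spelled out: `mstarOfRecord d = d%2 + 2d − 1` (★ №3; the literal of ★ p859102 `…_mstar_eq` ∕ ★ p859349). [cite: Rogawski1990, §4.9 Prop. 4.9.1 (b) p. 55] -/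
theorem mstarOfRecord_eq (d : ℕ) : mstarOfRecord d = d % 2 + 2 * d - 1 := rfl

/-- The CLEAN square level of ★ p859477 is the leaf's `m_c`: `2·((d%2 + 3d − 1)∕2) = mcOfRecord d` (every `d`). [cite: Rogawski1990, §4.9 Prop. 4.9.1 (b) p. 55] -/
theorem two_mul_kc_eq_mcOfRecord (d : ℕ) : 2 * ((d % 2 + 3 * d - 1) / 2) = mcOfRecord d := by
  unfold mcOfRecord mstarOfRecord; omega

/-- The Levi exponent of the labelled piece `T₊` (★ p859349), of `T₋`'s second term (★ p859464) and of the clean shell (★ p859477) is the leaf's `s_T`: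
`(d%2 + 3d − 1)∕2 − ⌊d∕2⌋ = sTOfRecord d` (every `d`; `= d − 1 + ℓ₀`). [cite: Rogawski1990, §4.9 Prop. 4.9.1 (a)(b) p. 55] -/
theorem kcExp_eq_sTOfRecord (d : ℕ) : (d % 2 + 3 * d - 1) / 2 - d / 2 = sTOfRecord d := by
  unfold sTOfRecord; omega

/-! ## §2  The two-level exponent `e(a,b;d)` of ★ p859102 at the five level pairs of record -/

/-- LOWER shell half at the level of record, `(a,b) = (ℓ₀, m*)`: `e(laLowOfRecord d, mstarOfRecord d; d) = csOfRecord d = ⌈d∕2⌉` (every `d`) — the `Alo` slot's shift.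
[cite: Rogawski1990, §4.9 Prop. 4.9.1 (a)(b) p. 55] [cite: Kottwitz1986BaseChangeUnits, §1 pp. 240–241] -/
theorem leviExp_laLow_mstarOfRecord (d : ℕ) :
    (max (max (laLowOfRecord d) ((mstarOfRecord d + 1) / 2)) ((laLowOfRecord d + d) / 2) - d / 2) + (laLowOfRecord d - d % 2 + 1) / 2 = csOfRecord d := by
  unfold laLowOfRecord mstarOfRecord csOfRecord; omega

/-- The square-level piece as the two-level piece `(0, m*)` (★ `indicator_levels_zero_eq_sqLevel`, LH4-p06 (g6)): `e(0, mstarOfRecord d; d) = csOfRecord d` (every `d`) — the `Asq`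
slot's shift. [cite: Rogawski1990, §4.9 Prop. 4.9.1 (a)(b) p. 55] [cite: Kottwitz1986BaseChangeUnits, §1 pp. 240–241] -/
theorem leviExp_zero_mstarOfRecord (d : ℕ) :
    (max (max 0 ((mstarOfRecord d + 1) / 2)) ((0 + d) / 2) - d / 2) + (0 - d % 2 + 1) / 2 = csOfRecord d := by
  unfold mstarOfRecord csOfRecord; omega

/-- The square-level exponent of ★ `measure_setOf_mem_and_sqLevel_eq` at `m = m*`: `max ⌈m*∕2⌉ ⌊d∕2⌋ − ⌊d∕2⌋ = csOfRecord d` (every `d`; ★ `…_sqLevel_mstar_eq`'s `(d+1)∕2`).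
[cite: Rogawski1990, §4.9 Prop. 4.9.1 (a)(b) p. 55] -/
theorem sqExp_mstarOfRecord (d : ℕ) : max ((mstarOfRecord d + 1) / 2) (d / 2) - d / 2 = csOfRecord d := by
  have h : (mstarOfRecord d + 1) / 2 = d := by unfold mstarOfRecord; omega
  rw [h]; unfold csOfRecord; omega

/-- UPPER shell half at the level of record, `(a,b) = (ℓ₀+1, m*)`: `e(laHighOfRecord d, mstarOfRecord d; d) = klOfRecord d` (EVERY `d` — the leaf's `kl` IS this exponent by
construction; `= ⌈d∕2⌉ + 1` for `d ≥ 2`, `= 2 + ℓ₀` exactly on `d ∈ {2, 3}`) — the `Ahi` slot's shift. [cite: Rogawski1990, §4.9 Prop. 4.9.1 (a)(b) p. 55] [cite: Kottwitz1986BaseChangeUnits, §1 pp. 240–241] -/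
theorem leviExp_laHigh_mstarOfRecord (d : ℕ) :
    (max (max (laHighOfRecord d) ((mstarOfRecord d + 1) / 2)) ((laHighOfRecord d + d) / 2) - d / 2) + (laHighOfRecord d - d % 2 + 1) / 2 = klOfRecord d := by
  unfold laHighOfRecord mstarOfRecord klOfRecord; omega

/-- LOWER CLEAN half, `(a,b) = (ℓ₀, m_c)`: `e(laLowOfRecord d, mcOfRecord d; d) = sTOfRecord d` (every `d`) — the exponent `s` of (T4) and of `2ρ_{T₊}` (★ p859477 §3).
[cite: Rogawski1990, §4.9 Prop. 4.9.1 (a)(b) p. 55] [cite: Kottwitz1986BaseChangeUnits, §1 pp. 240–241] -/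
theorem leviExp_laLow_mcOfRecord (d : ℕ) :
    (max (max (laLowOfRecord d) ((mcOfRecord d + 1) / 2)) ((laLowOfRecord d + d) / 2) - d / 2) + (laLowOfRecord d - d % 2 + 1) / 2 = sTOfRecord d := by
  unfold laLowOfRecord mcOfRecord mstarOfRecord sTOfRecord; omega

/-- UPPER CLEAN half, `(a,b) = (ℓ₀+1, m_c)`, WILD `d ≥ 2`: `e(laHighOfRecord d, mcOfRecord d; d) = sTOfRecord d + 1` — the exponent `s + 1` of (T5) (at `d = 1` the left side is `3`,
the right side `2`: the tame corner is off the road). [cite: Rogawski1990, §4.9 Prop. 4.9.1 (a)(b) p. 55] [cite: Kottwitz1986BaseChangeUnits, §1 pp. 240–241] -/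
theorem leviExp_laHigh_mcOfRecord {d : ℕ} (hd : 2 ≤ d) :
    (max (max (laHighOfRecord d) ((mcOfRecord d + 1) / 2)) ((laHighOfRecord d + d) / 2) - d / 2) + (laHighOfRecord d - d % 2 + 1) / 2 = sTOfRecord d + 1 := by
  unfold laHighOfRecord mcOfRecord mstarOfRecord sTOfRecord; omega

/-- The square-level exponent of ★ `measure_setOf_mem_and_sqLevel_eq` at the CLEAN level `m = m_c`: `max ⌈m_c∕2⌉ ⌊d∕2⌋ − ⌊d∕2⌋ = sTOfRecord d` (every `d`).
[cite: Rogawski1990, §4.9 Prop. 4.9.1 (a)(b) p. 55] -/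
theorem sqExp_mcOfRecord (d : ℕ) : max ((mcOfRecord d + 1) / 2) (d / 2) - d / 2 = sTOfRecord d := by
  have h : (mcOfRecord d + 1) / 2 = (d % 2 + 3 * d - 1) / 2 := by unfold mcOfRecord mstarOfRecord; omega
  rw [h]; unfold sTOfRecord; omega

/-! ## §3  Consequences the scalar checks read: the shell of record splits `cs ↦ kl`, the clean shell `s ↦ s + 1` -/

/-- On the shell of record the two halves' exponents differ by `klOfRecord d − csOfRecord d = 1` for WILD `d ≥ 2` (so `ρ(lev_{ℓ₀,m*}) − ρ(lev_{ℓ₀+1,m*}) = (1 − q⁻¹)·q^{−⌈d∕2⌉}`,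
the shell volume ★ p859426 `measure_setOf_mem_and_nearTransvShell_eq`); at `d = 1` the gap is `2`. [cite: Rogawski1990, §4.9 Prop. 4.9.1 (a)(b) p. 55] -/
theorem klOfRecord_eq_csOfRecord_add_one {d : ℕ} (hd : 2 ≤ d) : klOfRecord d = csOfRecord d + 1 := by
  unfold klOfRecord csOfRecord; omega

/-- The clean lower half's exponent exceeds the shell-of-record lower half's by `sTOfRecord d − csOfRecord d = ⌊d∕2⌋ − 1 + ℓ₀` (WILD `d ≥ 2`), i.e. `s_T = d − 1 + ℓ₀ = ⌈d∕2⌉ + ⌊d∕2⌋ − 1 + ℓ₀`: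
the drop from the `m*`-shell to the clean `m_c`-shell in the unipotent fibre. [cite: Rogawski1990, §4.9 Prop. 4.9.1 (a)(b) p. 55] -/
theorem sTOfRecord_eq_csOfRecord_add {d : ℕ} (hd : 2 ≤ d) : sTOfRecord d = csOfRecord d + (d / 2 - 1 + d % 2) := by
  unfold sTOfRecord csOfRecord; omega

end Summit.HodgeConjecture.HodgeConjecture.Cruxes.H413.F0P3cDyRamLeviExponentsOfRecord
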